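import Summits.BirchSwinnertonDyer.BirchSwinnertonDyer.Theorems.AlignedTransportAtTwoMainConjectureOfRankZeroBSDAtTwoCubicSplitStratumRelationMatrixCoordDoor
import Summits.BirchSwinnertonDyer.BirchSwinnertonDyer.Theorems.ByReductionTypeAtTwoTowerClass29359b
import Summits.BirchSwinnertonDyer.BirchSwinnertonDyer.Theorems.AlignedTransportAtTwoMainConjectureOfRankZeroBSDAtTwoCubicSplitStratumRelationMatrixRowN1727Certs
import HarnessLib

/-!
# Route `AlignedTransportAtTwo`, crux C2 `MainConjectureOfRankZeroBSDAtTwo` (stmt-BirchSwinnertonDyer-22298):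
# THE `−1727` ROW AT THE TWIN `29359b1 = [1, 0, 1, 64629, -11438055]` — same cubic field (discriminant `−1727`), same certificates (`…RowN1727Certs`), `θ` re-expressed in this
# curve's `β`: ★★★ **`rank₂ Cl(K_m) ≤ 2 ∀ m`, `μ₂ = 0`, `λ₂ ≤ 2` — UNCONDITIONALLY — for every cyclotomic `ℤ₂`-extension of `ℚ(β)`, `β` any `2`-division root of `29359b1`**, from a `2 × 2` RELATION MATRIX `diag(1 + X, 2 + X + X²)` on the classes of two degree-one primes
# `𝔮₁ = (q₁, s₂ − 5)` (over `17`) and `𝔮₂ = (q₂, s₂ − 4)` (over `97`) of `K_2 = ℚ(β)·ℚ(ζ₁₆)⁺` (degree `12`), determinant `(X − 1)²·X + 2(1 + X + 2X²)` (`d = 2`)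

HONEST FRAMING (cell `bsd-f1-sign2`, WIDTH-5 attached prover seat `bsd-line-att-p3` gen 55 on line `birth` of the lead `bsd-line-att-p2`; `--supports`
stmt-BirchSwinnertonDyer-22298, closes nothing; BSD is NOT proved by any of this; the crux C2, its verdict «blocked-on `Rank1Residual.GreenbergMuConjectureIrreducible`»
and every registered stub are untouched).  THEOREMS ONLY (no `def`, no named fact, no instance, no `sorry`).

WHAT.  `W = 29359b1 = [1, 0, 1, 64629, -11438055]` (`N = 29359 = 17·1727`; `E[2]` irreducible, no rational `2`-torsion abscissa, `Δ < 0`; kernel facts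
`Theorems/ByReductionTypeAtTwoTowerClass29359b`); its `2`-division field IS the cubic field of discriminant `−1727` of `1727a1` (`4β = (44, 433, -133)` on `(1, θ, δ)`):
`K = ℚ(β) = ℚ(θ)`, `θ = 1349651 / 1538636 + (265785 / 26156812)β + (133 / 6539203)β²`, `f(θ) = 0`,
`f = X³ − X − 16`; `𝓞_K = ℤ ⊕ ℤθ ⊕ ℤδ`, `δ = (θ² + θ)/2` (NO power integral basis: `2` is a common index divisor; this seat's
`Literature/…/CubicFieldDiscriminant1727{,ClassNumber}`: `CubicDisc1727.mul_table` `θ² = −θ + 2δ`, `θδ = 8 + δ`, `δ² = 8 + 4θ + δ`; `h_K = 1`, `d_K = −1727`).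
att-p3 g53's census: this is the one turnkey split-stratum field with `r = rank₂ Cl(K(√2)) = 2` (all three dyadic bits of the fundamental unit are `0`), so NO
one-relation door fires; att-p3 g54 built the two-generator door (`IwasawaTheory.classicalMuVanishes_two_of_relationMatrixCert_layer_two`, W-level
`…CubicSplitStratumRelationMatrixCoordDoor`); THIS file is its first ROW.
DATA (every number re-verified by the kernel; found kit-free on the seat by a 12-dimensional relation harvest in `𝓞_{K_2} = 𝓞_K ⊗ ℤ[s₂]`, `s₁² = 2`, `s₂² = 2 + s₁`,
relation lattice of index `8 = h(K_2)` on the eight conjugates of `𝔮₁, 𝔮₂`, unit lattice of rank `7`, and a twisted-norm LLL for the two generators):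
dyadic primes `𝔭_A = (π_A)`, `𝔭_B = (π_B)`, `𝔭_C = (π_C)`, `π_A = 18 + 5θ + 6δ`, `π_B = 3 + θ + δ`, `π_C = 3 + 8θ − 5δ` (`π_A π_B π_C = 2`); the unit
`ε = −849 − 560θ + 482δ` (`ε⁻¹ = 1497967 + 410176θ + 496578δ`; `ε ≡ −1 (𝔭_A³)`, `−1 (𝔭_B³)`, `+1 (𝔭_C³)` — bits `(0,0,0)`; `±ε` non-squares at `ψ₅ : θ ↦ 2, δ ↦ 3`,
`ε ↦ 2`); `q₁ = 7 + 2θ + 2δ` (norm `17`, `(q₁) = (17, θ − 12)`, `q₁ ≡ +3 (𝔭_C³)`), `q₂ = −29 + 6δ` (norm `97`, `(q₂) = (97, θ − 6)`, `q₂ ≡ +3 (𝔭_B³)`),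
`q₁q₂ ≡ −3 (𝔭_A³)`; `t₁ = 5` (`17 ∥ P₂(5) = 527`), `t₂ = 4` (`97 ∥ P₂(4) = 194`), `P₂ = (X² − 2)² − 2`; `σ : s₂ ↦ s₁s₂ − s₂`.  Numerically (census-grade,
kit j300990, and this seat's lattice) `Cl(K_2) ≅ ℤ/4 × ℤ/2 = ⟨[𝔮₂]⟩ × ⟨[𝔮₁]⟩` with `σ` acting TRIVIALLY; the rows: `(1 + X ∣ 0)` — `𝔮₁·σ(𝔮₁) = (y)`,
`y = 1 − s₁ + ((−1 − 2θ + δ) + (−1 − θ + δ)s₁)s₂`, `N_{K_2/K}(y) = ε·q₁²`; `(0 ∣ 2 + X + X²)` — `𝔮₂²·σ(𝔮₂)·σ²(𝔮₂) = (z)`,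
`z = (47 − 120θ + 56δ) + (−41 + 83θ − 37δ)s₁ + ((−66 + 160θ − 74δ) + (50 − 112θ + 51δ)s₁)s₂`, `N_{K_2/K}(z) = q₂⁴`; determinant
`(1 + X)(2 + X + X²) = (X − 1)²·X + 2·(1 + X + 2X²)` (`d = 2`, `u = X`, `u(1) = 1` odd, `d + 2 = 4 ≤ 4`).  Membership certificates are two-term
(`y = λ q^e + μ (σ^i s₂ − t)^e`), each identity ONE `linear_combination` whose multipliers are the exact quotients of the normal-form reduction in
`ℤ[X, Y][S₁, S₂]` modulo the multiplication table and `S₁² = 2`, `S₂² = 2 + S₁` (seat generator `gen/mkrow.py`).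
THEN (★★★ `classGroupPRank_le_and_mu_lambda_cubicField_29359b1`, UNCONDITIONAL): for `β` ANY root of the `2`-division cubic of `29359b1` and EVERY cyclotomic
`ℤ₂`-extension `κ` of `ℚ(β)`: `rank₂ Cl(K_m) ≤ 2 ∀ m`, `μ₂(κ) = 0`, `λ₂(κ) ≤ 2` (numerically `λ₂ = 2`: the bound is sharp).  §1–§2 are stated over ANY
number field `F` of degree `3` with a root `α` of `f` (short types); §3 specialises to `ℚ(β)`.  BSD is NOT proved; nothing is closed; C2's verdict is untouched.

References: [Washington1997] §13.3 Prop. 13.22–13.23; [Lang1990] Ch. 5 §3, Ch. 13 §4 Lemma 4.1; [Gras2003] IV.4; [NeukirchANT1999] Ch. I §3, §8, Ch. III (1.6)–(1.7);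
[Cohen1993] §4.7, §6.5; [Marcus2018] Ch. 2 Ex. 27, Ch. 3 Thm. 27; [LMFDB] ec 1727.a1, nf 3.1.1727.1; [CremonaAlgorithms1997] Table 1; tree: att-p3 g54
`…CubicSplitStratumRelationMatrixCoordDoor` (p836128), `Literature/…/ClassicalMuVanishesLayerTwoRelationMatrixCertificateTwo` (p836004), this seat's
`CubicDisc1727*` (p837153, p837258), `Theorems/ByReductionTypeAtTwoTowerClass1727a`.
-/

set_option linter.dupNamespace false
set_option autoImplicit false

noncomputable section

open scoped Classical NumberField nonZeroDivisors IntermediateField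

namespace Summit.BirchSwinnertonDyer.BirchSwinnertonDyer.Theorems.AlignedTransportAtTwoCubicSplitStratumRelationMatrixRowN1727

open NumberField IsDedekindDomain Polynomial WeierstrassCurve IntermediateField CongruenceSubgroup Module Finset
  Literature.NumberTheory.IwasawaTheory Literature.NumberTheory.GaloisRepresentations
  Literature.NumberTheory.EllipticCurves Literature.NumberTheory.EllipticCurves.Greenberg1999
  Literature.NumberTheory.EllipticCurves.ModularForms Literature.NumberTheory.EllipticCurves.Rank1Residual Literature.NumberTheory.EllipticCurves.Module
  Literature.NumberTheory.NumberFields Literature.NumberTheory.CubicFields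
  Summit.BirchSwinnertonDyer.Rank1Residual Summit.BirchSwinnertonDyer.Rank1Residual.X1.MuLambda
  Summit.BirchSwinnertonDyer.Rank1Residual.X5 Summit.BirchSwinnertonDyer.Rank1Residual.X5.O1 Summit.BirchSwinnertonDyer.Rank1Residual.X5.Instances
  Summit.BirchSwinnertonDyer.Rank1Residual.F1Sign2 Summit.BirchSwinnertonDyer.BirchSwinnertonDyer.Theorems.Rank1ResidualX1Defs
  Summit.BirchSwinnertonDyer.BirchSwinnertonDyer.Theses.AlignedTransportAtTwo
  Summit.BirchSwinnertonDyer.BirchSwinnertonDyer.Theorems.TowerClass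
open Summit.BirchSwinnertonDyer.BirchSwinnertonDyer.Theorems.AlignedTransportAtTwoCubicKilfordPrimes (psi_gen_eq_zero)

/-! ## §3 ★★★ THE ROW at `29359b1` (same field as `1727a1`): `rank₂ Cl(K_m) ≤ 2 ∀ m`, `μ₂ = 0`, `λ₂ ≤ 2` — UNCONDITIONAL -/

/-- `Δ(29359b1) = -73848550736485943 < 0`. [cite: CremonaAlgorithms1997, Table 1] -/
theorem Δ_neg_c29359b1 : c29359b1.Δ < 0 := by
  rw [baseChange_int_Δ, M29359b1_Δ]; norm_num

/-- **`θ := 1349651 / 1538636 + (265785 / 26156812)β + (133 / 6539203)β² ∈ ℚ(β)` is a root of `f = X³ − X − 16`** (one `linear_combination` against `ψ_W(β) = 4β³ + (1)β² + (258518)β + (-45752219) = 0`; the multiplier is the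
exact quotient in `ℚ[β]`). [cite: LMFDB, number field 3.1.1727.1 (defining polynomial)] [cite: SilvermanAEC2009, III.1] -/
theorem aeval_theta_29359b1 {β : AlgebraicClosure ℚ} (hβ : aeval β c29359b1.twoTorsionPolynomial.toPoly = 0) :
    aeval ((1349651 / 1538636 : ↥(IntermediateField.adjoin ℚ ({β} : Set (AlgebraicClosure ℚ)))) + (265785 / 26156812 : ↥(IntermediateField.adjoin ℚ ({β} : Set (AlgebraicClosure ℚ)))) * (AdjoinSimple.gen ℚ β : ↥(IntermediateField.adjoin ℚ ({β} : Set (AlgebraicClosure ℚ)))) + (133 / 6539203 : ↥(IntermediateField.adjoin ℚ ({β} : Set (AlgebraicClosure ℚ)))) * (AdjoinSimple.gen ℚ β : ↥(IntermediateField.adjoin ℚ ({β} : Set (AlgebraicClosure ℚ)))) ^ 2) (MonicCubic.poly 0 (-1) (-16)) = 0 := by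
  have hψ := psi_gen_eq_zero c29359b1 hβ
  rw [c29359b1_b.1, c29359b1_b.2.1, c29359b1_b.2.2] at hψ
  set g : ↥(IntermediateField.adjoin ℚ ({β} : Set (AlgebraicClosure ℚ))) := AdjoinSimple.gen ℚ β with hg
  simp only [MonicCubic.poly, map_add, map_mul, map_pow, aeval_X, eq_intCast, map_intCast]
  push_cast at hψ ⊢
  linear_combination ((21929042481263 / 61923656097814658752 : ↥(IntermediateField.adjoin ℚ ({β} : Set (AlgebraicClosure ℚ)))) * g ^ 0 + (1800553995877 / 1052702153662849198784 : ↥(IntermediateField.adjoin ℚ ({β} : Set (AlgebraicClosure ℚ)))) * g ^ 1 + (7051029979 / 2236992076533554547416 : ↥(IntermediateField.adjoin ℚ ({β} : Set (AlgebraicClosure ℚ)))) * g ^ 2 + (2352637 / 1118496038266777273708 : ↥(IntermediateField.adjoin ℚ ({β} : Set (AlgebraicClosure ℚ)))) * g ^ 3) * hψ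

/-- `[ℚ(β) : ℚ] = 3`. [cite: SilvermanAEC2009, III.2.3 (b)] -/
theorem finrank_cubicField_29359b1 {β : AlgebraicClosure ℚ} (hβ : aeval β c29359b1.twoTorsionPolynomial.toPoly = 0) :
    finrank ℚ ↥(IntermediateField.adjoin ℚ ({β} : Set (AlgebraicClosure ℚ))) = 3 :=
  AddKatoTwo.finrank_adjoin_root_twoTorsionPolynomial_eq_three _ irr_two_29359b1 hβ

/-- **`d_{ℚ(β)} = −1727`** for `29359b1`. [cite: LMFDB, number field 3.1.1727.1 (discriminant −1727)] -/
theorem discr_cubicField_29359b1 {β : AlgebraicClosure ℚ} (hβ : aeval β c29359b1.twoTorsionPolynomial.toPoly = 0) :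
    (haveI : FiniteDimensional ℚ ↥(IntermediateField.adjoin ℚ ({β} : Set (AlgebraicClosure ℚ))) := IntermediateField.adjoin.finiteDimensional ((AlgebraicClosure.isAlgebraic ℚ).isAlgebraic β).isIntegral;
      haveI : NumberField ↥(IntermediateField.adjoin ℚ ({β} : Set (AlgebraicClosure ℚ))) := NumberField.mk;
      NumberField.discr ↥(IntermediateField.adjoin ℚ ({β} : Set (AlgebraicClosure ℚ))) = -1727) := by
  haveI : FiniteDimensional ℚ ↥(IntermediateField.adjoin ℚ ({β} : Set (AlgebraicClosure ℚ))) := IntermediateField.adjoin.finiteDimensional ((AlgebraicClosure.isAlgebraic ℚ).isAlgebraic β).isIntegral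
  haveI : NumberField ↥(IntermediateField.adjoin ℚ ({β} : Set (AlgebraicClosure ℚ))) := NumberField.mk
  exact CubicDisc1727.discr_eq (finrank_cubicField_29359b1 hβ) (aeval_theta_29359b1 hβ)

/-- ★ **`h(ℚ(β)) = 1`** for `29359b1` (this seat's `CubicDisc1727.classNumber_eq_one`). [cite: LMFDB, number field 3.1.1727.1 (class number 1)] -/
theorem classNumber_cubicField_29359b1_eq_one {β : AlgebraicClosure ℚ} (hβ : aeval β c29359b1.twoTorsionPolynomial.toPoly = 0) :
    (haveI : FiniteDimensional ℚ ↥(IntermediateField.adjoin ℚ ({β} : Set (AlgebraicClosure ℚ))) := IntermediateField.adjoin.finiteDimensional ((AlgebraicClosure.isAlgebraic ℚ).isAlgebraic β).isIntegral;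
      haveI : NumberField ↥(IntermediateField.adjoin ℚ ({β} : Set (AlgebraicClosure ℚ))) := NumberField.mk;
      classNumber ↥(IntermediateField.adjoin ℚ ({β} : Set (AlgebraicClosure ℚ))) = 1) := by
  haveI : FiniteDimensional ℚ ↥(IntermediateField.adjoin ℚ ({β} : Set (AlgebraicClosure ℚ))) := IntermediateField.adjoin.finiteDimensional ((AlgebraicClosure.isAlgebraic ℚ).isAlgebraic β).isIntegral
  haveI : NumberField ↥(IntermediateField.adjoin ℚ ({β} : Set (AlgebraicClosure ℚ))) := NumberField.mk
  exact CubicDisc1727.classNumber_eq_one (finrank_cubicField_29359b1 hβ) (aeval_theta_29359b1 hβ)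

set_option maxHeartbeats 1600000 in
/-- ★★★ **THE `−1727` ROW AT THE TWIN `29359b1` (UNCONDITIONAL): for `β` ANY root of the `2`-division cubic of `29359b1` and EVERY cyclotomic `ℤ₂`-extension `κ` of `ℚ(β)` —
`rank₂ Cl(K_m) ≤ 2` for all `m`, `μ₂(κ) = 0`, `λ₂(κ) ≤ 2`** — att-p3 g54's two-generator relation door in coordinates fed with the `2 × 2` relation matrix
`diag(1 + X, 2 + X + X²)` on `([𝔮₁], [𝔮₂])` in `Cl(ℚ(β)·ℚ(ζ₁₆)⁺)` and the three dyadic symbols (module docstring).  Nothing about BSD is asserted.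
[cite: Washington1997, §13.3 Prop. 13.22–13.23] [cite: Lang1990, Ch. 13 §4, Lemma 4.1] [cite: Gras2003, IV.4] [cite: NeukirchANT1999, Ch. III (1.6)–(1.7)]
[cite: Cohen1993, §4.7, §6.5] [cite: LMFDB, number field 3.1.1727.1] -/
theorem classGroupPRank_le_and_mu_lambda_cubicField_29359b1 {β : AlgebraicClosure ℚ} (hβ : aeval β c29359b1.twoTorsionPolynomial.toPoly = 0)
    (κP : ZpExtension ↥(IntermediateField.adjoin ℚ ({β} : Set (AlgebraicClosure ℚ))) 2) (hκP : κP.IsCyclotomic) :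
    (∀ m, classGroupPRank κP m ≤ 2) ∧ ClassicalMuVanishes κP ∧ classicalLambda κP ≤ 2 := by
  haveI : FiniteDimensional ℚ ↥(IntermediateField.adjoin ℚ ({β} : Set (AlgebraicClosure ℚ))) := IntermediateField.adjoin.finiteDimensional ((AlgebraicClosure.isAlgebraic ℚ).isAlgebraic β).isIntegral
  haveI : NumberField ↥(IntermediateField.adjoin ℚ ({β} : Set (AlgebraicClosure ℚ))) := NumberField.mk
  have ht := not_hasRationalTwoTorsionX_29359b1
  have hθ := aeval_theta_29359b1 hβ
  have h3 := finrank_cubicField_29359b1 hβ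
  have hd : ¬ (2 : ℤ) ∣ NumberField.discr ↥(IntermediateField.adjoin ℚ ({β} : Set (AlgebraicClosure ℚ))) := by
    rw [CubicDisc1727.discr_eq h3 hθ]; norm_num
  have hh : ¬ 2 ∣ classNumber ↥(IntermediateField.adjoin ℚ ({β} : Set (AlgebraicClosure ℚ))) := CubicDisc1727.not_two_dvd_classNumber h3 hθ
  obtain ⟨ψ, hψ⟩ := exists_residueHom_17 h3 hθ
  obtain ⟨ω, hω⟩ := exists_residueHom_97 h3 hθ
  obtain ⟨χ, hχ⟩ := exists_residueHom_5 h3 hθ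
  have hmax1 := isMaximal_span_q₁ h3 hθ
  have hmax2 := isMaximal_span_q₂ h3 hθ
  have hy10 := mem_y_q1_s0 hθ
  have hy11 := mem_y_q1_s1 hθ
  have hy12 := mem_y_q1_s2 hθ
  have hy13 := mem_y_q1_s3 hθ
  have hy20 := mem_y_q2_s0 hθ
  have hy21 := mem_y_q2_s1 hθ
  have hy22 := mem_y_q2_s2 hθ
  have hy23 := mem_y_q2_s3 hθ
  have hz10 := mem_z_q1_s0 hθ
  have hz11 := mem_z_q1_s1 hθ
  have hz12 := mem_z_q1_s2 hθ
  have hz13 := mem_z_q1_s3 hθ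
  have hz20 := mem_z_q2_s0 hθ
  have hz21 := mem_z_q2_s1 hθ
  have hz22 := mem_z_q2_s2 hθ
  have hz23 := mem_z_q2_s3 hθ
  set θI : 𝓞 ↥(IntermediateField.adjoin ℚ ({β} : Set (AlgebraicClosure ℚ))) := MonicCubic.thetaInt hθ with hθI
  set δI : 𝓞 ↥(IntermediateField.adjoin ℚ ({β} : Set (AlgebraicClosure ℚ))) := MonicCubic.thetaInt (CubicDisc1727.delta_root hθ) with hδI
  obtain ⟨hX2, hXY, hY2⟩ := CubicDisc1727.mul_table hθ
  have hden := CubicDisc1727.den_delta hθ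
  rw [← hθI, ← hδI] at hX2 hXY hY2 hden
  -- residues of `δ = (θ² + θ)/2`
  have hψδ : ψ δI = (10 : ZMod 17) := by
    have h := congrArg ψ hden
    simp only [map_mul, map_add, map_pow, map_ofNat, hψ] at h
    have h2 : (9 : ZMod 17) * 2 = 1 := by decide
    calc ψ δI = ((9 : ZMod 17) * 2) * ψ δI := by rw [h2, one_mul]
      _ = (9 : ZMod 17) * (2 * ψ δI) := by ring
      _ = (10 : ZMod 17) := by rw [h]; decide
  have hωδ : ω δI = (21 : ZMod 97) := by
    have h := congrArg ω hden
    simp only [map_mul, map_add, map_pow, map_ofNat, hω] at h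
    have h2 : (49 : ZMod 97) * 2 = 1 := by decide
    calc ω δI = ((49 : ZMod 97) * 2) * ω δI := by rw [h2, one_mul]
      _ = (49 : ZMod 97) * (2 * ω δI) := by ring
      _ = (21 : ZMod 97) := by rw [h]; decide
  have hχδ : χ δI = (3 : ZMod 5) := by
    have h := congrArg χ hden
    simp only [map_mul, map_add, map_pow, map_ofNat, hχ] at h
    have h2 : (3 : ZMod 5) * 2 = 1 := by decide
    calc χ δI = ((3 : ZMod 5) * 2) * χ δI := by rw [h2, one_mul]
      _ = (3 : ZMod 5) * (2 * χ δI) := by ring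
      _ = (3 : ZMod 5) := by rw [h]; decide
  -- the unit `ε`: `ε·ε⁻¹ = 1`, `±ε` non-squares at `ψ_5`, `ε ≡ ±1 (mod 𝔭_j³)`
  have hεmul : ((-849 : 𝓞 ↥(IntermediateField.adjoin ℚ ({β} : Set (AlgebraicClosure ℚ)))) + (-560 : 𝓞 ↥(IntermediateField.adjoin ℚ ({β} : Set (AlgebraicClosure ℚ)))) * θI + (482 : 𝓞 ↥(IntermediateField.adjoin ℚ ({β} : Set (AlgebraicClosure ℚ)))) * δI) * ((1497967 : 𝓞 ↥(IntermediateField.adjoin ℚ ({β} : Set (AlgebraicClosure ℚ)))) + (410176 : 𝓞 ↥(IntermediateField.adjoin ℚ ({β} : Set (AlgebraicClosure ℚ)))) * θI + (496578 : 𝓞 ↥(IntermediateField.adjoin ℚ ({β} : Set (AlgebraicClosure ℚ)))) * δI) = 1 := by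
    linear_combination ((-229698560 : 𝓞 ↥(IntermediateField.adjoin ℚ ({β} : Set (AlgebraicClosure ℚ))))) * hX2 + ((-80378848 : 𝓞 ↥(IntermediateField.adjoin ℚ ({β} : Set (AlgebraicClosure ℚ))))) * hXY + ((239350596 : 𝓞 ↥(IntermediateField.adjoin ℚ ({β} : Set (AlgebraicClosure ℚ))))) * hY2
  have hχε : χ ((-849 : 𝓞 ↥(IntermediateField.adjoin ℚ ({β} : Set (AlgebraicClosure ℚ)))) + (-560 : 𝓞 ↥(IntermediateField.adjoin ℚ ({β} : Set (AlgebraicClosure ℚ)))) * θI + (482 : 𝓞 ↥(IntermediateField.adjoin ℚ ({β} : Set (AlgebraicClosure ℚ)))) * δI) = (2 : ZMod 5) := by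
    simp only [map_add, map_mul, map_neg, map_ofNat, hχ, hχδ]; decide
  have hnsq : ∀ w : (𝓞 ↥(IntermediateField.adjoin ℚ ({β} : Set (AlgebraicClosure ℚ))))ˣ, Units.mkOfMulEqOne _ _ hεmul ≠ w ^ 2 ∧ Units.mkOfMulEqOne _ _ hεmul ≠ -w ^ 2 := by
    intro w
    refine ⟨fun h => ?_, fun h => ?_⟩
    · have h' := congrArg (fun x : (𝓞 ↥(IntermediateField.adjoin ℚ ({β} : Set (AlgebraicClosure ℚ))))ˣ => χ (x : 𝓞 ↥(IntermediateField.adjoin ℚ ({β} : Set (AlgebraicClosure ℚ))))) h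
      simp only [Units.val_mkOfMulEqOne, Units.val_pow_eq_pow_val, map_pow] at h'
      rw [hχε] at h'
      exact absurd h'.symm (by generalize χ (w : 𝓞 ↥(IntermediateField.adjoin ℚ ({β} : Set (AlgebraicClosure ℚ)))) = u; revert u; decide)
    · have h' := congrArg (fun x : (𝓞 ↥(IntermediateField.adjoin ℚ ({β} : Set (AlgebraicClosure ℚ))))ˣ => χ (x : 𝓞 ↥(IntermediateField.adjoin ℚ ({β} : Set (AlgebraicClosure ℚ))))) h
      simp only [Units.val_mkOfMulEqOne, Units.val_neg, Units.val_pow_eq_pow_val, map_neg, map_pow] at h'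
      rw [hχε] at h'
      exact absurd h'.symm (by generalize χ (w : 𝓞 ↥(IntermediateField.adjoin ℚ ({β} : Set (AlgebraicClosure ℚ)))) = u; revert u; decide)
  -- the three dyadic primes `𝔭_C, 𝔭_B, 𝔭_A` (norm `2` by the norm form) and the congruences of `ε`
  have hNC : Ideal.absNorm (Ideal.span {((3 : 𝓞 ↥(IntermediateField.adjoin ℚ ({β} : Set (AlgebraicClosure ℚ)))) + (8 : 𝓞 ↥(IntermediateField.adjoin ℚ ({β} : Set (AlgebraicClosure ℚ)))) * θI + (-5 : 𝓞 ↥(IntermediateField.adjoin ℚ ({β} : Set (AlgebraicClosure ℚ)))) * δI)}) = 2 := by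
    rw [Ideal.absNorm_span_singleton]
    have h := CubicDisc1727.norm_piC h3 hθ
    rw [← hθI, ← hδI] at h
    rw [show ((3 : 𝓞 ↥(IntermediateField.adjoin ℚ ({β} : Set (AlgebraicClosure ℚ)))) + (8 : 𝓞 ↥(IntermediateField.adjoin ℚ ({β} : Set (AlgebraicClosure ℚ)))) * θI + (-5 : 𝓞 ↥(IntermediateField.adjoin ℚ ({β} : Set (AlgebraicClosure ℚ)))) * δI) = (3 : 𝓞 ↥(IntermediateField.adjoin ℚ ({β} : Set (AlgebraicClosure ℚ)))) + 8 * θI + (-5) * δI by ring, h]; rfl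
  have hNB : Ideal.absNorm (Ideal.span {((3 : 𝓞 ↥(IntermediateField.adjoin ℚ ({β} : Set (AlgebraicClosure ℚ)))) + (1 : 𝓞 ↥(IntermediateField.adjoin ℚ ({β} : Set (AlgebraicClosure ℚ)))) * θI + (1 : 𝓞 ↥(IntermediateField.adjoin ℚ ({β} : Set (AlgebraicClosure ℚ)))) * δI)}) = 2 := by
    rw [Ideal.absNorm_span_singleton]
    have h := CubicDisc1727.norm_piB h3 hθ
    rw [← hθI, ← hδI] at h
    rw [show ((3 : 𝓞 ↥(IntermediateField.adjoin ℚ ({β} : Set (AlgebraicClosure ℚ)))) + (1 : 𝓞 ↥(IntermediateField.adjoin ℚ ({β} : Set (AlgebraicClosure ℚ)))) * θI + (1 : 𝓞 ↥(IntermediateField.adjoin ℚ ({β} : Set (AlgebraicClosure ℚ)))) * δI) = (3 : 𝓞 ↥(IntermediateField.adjoin ℚ ({β} : Set (AlgebraicClosure ℚ)))) + θI + δI by ring, h]; rfl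
  have hNA : Ideal.absNorm (Ideal.span {((18 : 𝓞 ↥(IntermediateField.adjoin ℚ ({β} : Set (AlgebraicClosure ℚ)))) + (5 : 𝓞 ↥(IntermediateField.adjoin ℚ ({β} : Set (AlgebraicClosure ℚ)))) * θI + (6 : 𝓞 ↥(IntermediateField.adjoin ℚ ({β} : Set (AlgebraicClosure ℚ)))) * δI)}) = 2 := by
    rw [Ideal.absNorm_span_singleton]
    have h := CubicDisc1727.norm_piA h3 hθ
    rw [← hθI, ← hδI] at h
    rw [show ((18 : 𝓞 ↥(IntermediateField.adjoin ℚ ({β} : Set (AlgebraicClosure ℚ)))) + (5 : 𝓞 ↥(IntermediateField.adjoin ℚ ({β} : Set (AlgebraicClosure ℚ)))) * θI + (6 : 𝓞 ↥(IntermediateField.adjoin ℚ ({β} : Set (AlgebraicClosure ℚ)))) * δI) = (18 : 𝓞 ↥(IntermediateField.adjoin ℚ ({β} : Set (AlgebraicClosure ℚ)))) + 5 * θI + 6 * δI by ring, h]; rfl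
  have hεC : (Units.mkOfMulEqOne _ _ hεmul : (𝓞 ↥(IntermediateField.adjoin ℚ ({β} : Set (AlgebraicClosure ℚ))))ˣ).val - 1 ∈ (Ideal.span {((3 : 𝓞 ↥(IntermediateField.adjoin ℚ ({β} : Set (AlgebraicClosure ℚ)))) + (8 : 𝓞 ↥(IntermediateField.adjoin ℚ ({β} : Set (AlgebraicClosure ℚ)))) * θI + (-5 : 𝓞 ↥(IntermediateField.adjoin ℚ ({β} : Set (AlgebraicClosure ℚ)))) * δI)}) ^ 3 ∨ (Units.mkOfMulEqOne _ _ hεmul : (𝓞 ↥(IntermediateField.adjoin ℚ ({β} : Set (AlgebraicClosure ℚ))))ˣ).val + 1 ∈ (Ideal.span {((3 : 𝓞 ↥(IntermediateField.adjoin ℚ ({β} : Set (AlgebraicClosure ℚ)))) + (8 : 𝓞 ↥(IntermediateField.adjoin ℚ ({β} : Set (AlgebraicClosure ℚ)))) * θI + (-5 : 𝓞 ↥(IntermediateField.adjoin ℚ ({β} : Set (AlgebraicClosure ℚ)))) * δI)}) ^ 3 := by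
    rw [Units.val_mkOfMulEqOne]
    refine Or.inl ?_
    rw [Ideal.span_singleton_pow, Ideal.mem_span_singleton']
    exact ⟨((-9516014 : 𝓞 ↥(IntermediateField.adjoin ℚ ({β} : Set (AlgebraicClosure ℚ)))) + (-2605692 : 𝓞 ↥(IntermediateField.adjoin ℚ ({β} : Set (AlgebraicClosure ℚ)))) * θI + (-3154571 : 𝓞 ↥(IntermediateField.adjoin ℚ ({β} : Set (AlgebraicClosure ℚ)))) * δI), by linear_combination ((-1005090080 : 𝓞 ↥(IntermediateField.adjoin ℚ ({β} : Set (AlgebraicClosure ℚ)))) + (5639886208 : 𝓞 ↥(IntermediateField.adjoin ℚ ({β} : Set (AlgebraicClosure ℚ)))) * δI + (1464972960 : 𝓞 ↥(IntermediateField.adjoin ℚ ({β} : Set (AlgebraicClosure ℚ)))) * δI ^ 2 + (-5038963456 : 𝓞 ↥(IntermediateField.adjoin ℚ ({β} : Set (AlgebraicClosure ℚ)))) * θI + (886323968 : 𝓞 ↥(IntermediateField.adjoin ℚ ({β} : Set (AlgebraicClosure ℚ)))) * θI * δI + (-1334114304 : 𝓞 ↥(IntermediateField.adjoin ℚ ({β}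 : Set (AlgebraicClosure ℚ)))) * θI ^ 2) * hX2 + ((-248064076 : 𝓞 ↥(IntermediateField.adjoin ℚ ({β} : Set (AlgebraicClosure ℚ)))) + (-2139637504 : 𝓞 ↥(IntermediateField.adjoin ℚ ({β} : Set (AlgebraicClosure ℚ)))) * δI + (-1567031100 : 𝓞 ↥(IntermediateField.adjoin ℚ ({β} : Set (AlgebraicClosure ℚ)))) * δI ^ 2) * hXY + ((280180517 : 𝓞 ↥(IntermediateField.adjoin ℚ ({β} : Set (AlgebraicClosure ℚ)))) + (2236959470 : 𝓞 ↥(IntermediateField.adjoin ℚ ({β} : Set (AlgebraicClosure ℚ)))) * δI + (394321375 : 𝓞 ↥(IntermediateField.adjoin ℚ ({β} : Set (AlgebraicClosure ℚ)))) * δI ^ 2) * hY2⟩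
  have hεB : (Units.mkOfMulEqOne _ _ hεmul : (𝓞 ↥(IntermediateField.adjoin ℚ ({β} : Set (AlgebraicClosure ℚ))))ˣ).val - 1 ∈ (Ideal.span {((3 : 𝓞 ↥(IntermediateField.adjoin ℚ ({β} : Set (AlgebraicClosure ℚ)))) + (1 : 𝓞 ↥(IntermediateField.adjoin ℚ ({β} : Set (AlgebraicClosure ℚ)))) * θI + (1 : 𝓞 ↥(IntermediateField.adjoin ℚ ({β} : Set (AlgebraicClosure ℚ)))) * δI)}) ^ 3 ∨ (Units.mkOfMulEqOne _ _ hεmul : (𝓞 ↥(IntermediateField.adjoin ℚ ({β} : Set (AlgebraicClosure ℚ))))ˣ).val + 1 ∈ (Ideal.span {((3 : 𝓞 ↥(IntermediateField.adjoin ℚ ({β} : Set (AlgebraicClosure ℚ)))) + (1 : 𝓞 ↥(IntermediateField.adjoin ℚ ({β} : Set (AlgebraicClosure ℚ)))) * θI + (1 : 𝓞 ↥(IntermediateField.adjoin ℚ ({β} : Set (AlgebraicClosure ℚ)))) * δI)}) ^ 3 := by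
    rw [Units.val_mkOfMulEqOne]
    refine Or.inr ?_
    rw [Ideal.span_singleton_pow, Ideal.mem_span_singleton']
    exact ⟨((-13624 : 𝓞 ↥(IntermediateField.adjoin ℚ ({β} : Set (AlgebraicClosure ℚ)))) + (-5145 : 𝓞 ↥(IntermediateField.adjoin ℚ ({β} : Set (AlgebraicClosure ℚ)))) * θI + (5631 : 𝓞 ↥(IntermediateField.adjoin ℚ ({β} : Set (AlgebraicClosure ℚ)))) * δI), by linear_combination ((-206747 : 𝓞 ↥(IntermediateField.adjoin ℚ ({β} : Set (AlgebraicClosure ℚ)))) + (-83289 : 𝓞 ↥(IntermediateField.adjoin ℚ ({β} : Set (AlgebraicClosure ℚ)))) * δI + (1458 : 𝓞 ↥(IntermediateField.adjoin ℚ ({β} : Set (AlgebraicClosure ℚ)))) * δI ^ 2 + (-54784 : 𝓞 ↥(IntermediateField.adjoin ℚ ({β} : Set (AlgebraicClosure ℚ)))) * θI + (-9804 : 𝓞 ↥(IntermediateField.adjoin ℚ ({β} : Set (AlgebraicClosure ℚ)))) * θI * δI + (-5145 : 𝓞 ↥(IntermediateField.adjoin ℚ ({β} : Set (AlgebraicClosure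 ℚ)))) * θI ^ 2) * hX2 + ((-28989 : 𝓞 ↥(IntermediateField.adjoin ℚ ({β} : Set (AlgebraicClosure ℚ)))) + (15639 : 𝓞 ↥(IntermediateField.adjoin ℚ ({β} : Set (AlgebraicClosure ℚ)))) * δI + (11748 : 𝓞 ↥(IntermediateField.adjoin ℚ ({β} : Set (AlgebraicClosure ℚ)))) * δI ^ 2) * hXY + ((74864 : 𝓞 ↥(IntermediateField.adjoin ℚ ({β} : Set (AlgebraicClosure ℚ)))) + (57350 : 𝓞 ↥(IntermediateField.adjoin ℚ ({β} : Set (AlgebraicClosure ℚ)))) * δI + (5631 : 𝓞 ↥(IntermediateField.adjoin ℚ ({β} : Set (AlgebraicClosure ℚ)))) * δI ^ 2) * hY2⟩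
  have hεA : (Units.mkOfMulEqOne _ _ hεmul : (𝓞 ↥(IntermediateField.adjoin ℚ ({β} : Set (AlgebraicClosure ℚ))))ˣ).val - 1 ∈ (Ideal.span {((18 : 𝓞 ↥(IntermediateField.adjoin ℚ ({β} : Set (AlgebraicClosure ℚ)))) + (5 : 𝓞 ↥(IntermediateField.adjoin ℚ ({β} : Set (AlgebraicClosure ℚ)))) * θI + (6 : 𝓞 ↥(IntermediateField.adjoin ℚ ({β} : Set (AlgebraicClosure ℚ)))) * δI)}) ^ 3 ∨ (Units.mkOfMulEqOne _ _ hεmul : (𝓞 ↥(IntermediateField.adjoin ℚ ({β} : Set (AlgebraicClosure ℚ))))ˣ).val + 1 ∈ (Ideal.span {((18 : 𝓞 ↥(IntermediateField.adjoin ℚ ({β} : Set (AlgebraicClosure ℚ)))) + (5 : 𝓞 ↥(IntermediateField.adjoin ℚ ({β} : Set (AlgebraicClosure ℚ)))) * θI + (6 : 𝓞 ↥(IntermediateField.adjoin ℚ ({β} : Set (AlgebraicClosure ℚ)))) * δI)}) ^ 3 := by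
    rw [Units.val_mkOfMulEqOne]
    refine Or.inr ?_
    rw [Ideal.span_singleton_pow, Ideal.mem_span_singleton']
    exact ⟨((-218332 : 𝓞 ↥(IntermediateField.adjoin ℚ ({β} : Set (AlgebraicClosure ℚ)))) + (82820 : 𝓞 ↥(IntermediateField.adjoin ℚ ({β} : Set (AlgebraicClosure ℚ)))) * θI + (-270 : 𝓞 ↥(IntermediateField.adjoin ℚ ({β} : Set (AlgebraicClosure ℚ)))) * δI), by linear_combination ((33594000 : 𝓞 ↥(IntermediateField.adjoin ℚ ({β} : Set (AlgebraicClosure ℚ)))) + (153192650 : 𝓞 ↥(IntermediateField.adjoin ℚ ({β} : Set (AlgebraicClosure ℚ)))) * δI + (44601300 : 𝓞 ↥(IntermediateField.adjoin ℚ ({β} : Set (AlgebraicClosure ℚ)))) * δI ^ 2 + (74163000 : 𝓞 ↥(IntermediateField.adjoin ℚ ({β} : Set (AlgebraicClosure ℚ)))) * θI + (37235250 : 𝓞 ↥(IntermediateField.adjoin ℚ ({β} : Set (AlgebraicClosure ℚ)))) * θI * δI + (10352500 : 𝓞 ↥(IntermediateField.adjoin ℚ ({β} : Set (AlgebraicClosure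 ℚ)))) * θI ^ 2) * hX2 + ((6243742 : 𝓞 ↥(IntermediateField.adjoin ℚ ({β} : Set (AlgebraicClosure ℚ)))) + (71863920 : 𝓞 ↥(IntermediateField.adjoin ℚ ({β} : Set (AlgebraicClosure ℚ)))) * δI + (17743320 : 𝓞 ↥(IntermediateField.adjoin ℚ ({β} : Set (AlgebraicClosure ℚ)))) * δI ^ 2) * hXY + ((152920180 : 𝓞 ↥(IntermediateField.adjoin ℚ ({β} : Set (AlgebraicClosure ℚ)))) + (59203008 : 𝓞 ↥(IntermediateField.adjoin ℚ ({β} : Set (AlgebraicClosure ℚ)))) * δI + (-58320 : 𝓞 ↥(IntermediateField.adjoin ℚ ({β} : Set (AlgebraicClosure ℚ)))) * δI ^ 2) * hY2⟩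
  -- the dyadic symbols of `q₁`, `q₂`, `q₁q₂`
  have hπa : ((7 : 𝓞 ↥(IntermediateField.adjoin ℚ ({β} : Set (AlgebraicClosure ℚ)))) + (2 : 𝓞 ↥(IntermediateField.adjoin ℚ ({β} : Set (AlgebraicClosure ℚ)))) * θI + (2 : 𝓞 ↥(IntermediateField.adjoin ℚ ({β} : Set (AlgebraicClosure ℚ)))) * δI) - 3 ∈ (Ideal.span {((3 : 𝓞 ↥(IntermediateField.adjoin ℚ ({β} : Set (AlgebraicClosure ℚ)))) + (8 : 𝓞 ↥(IntermediateField.adjoin ℚ ({β} : Set (AlgebraicClosure ℚ)))) * θI + (-5 : 𝓞 ↥(IntermediateField.adjoin ℚ ({β} : Set (AlgebraicClosure ℚ)))) * δI)}) ^ 3 ∨ ((7 : 𝓞 ↥(IntermediateField.adjoin ℚ ({β} : Set (AlgebraicClosure ℚ)))) + (2 : 𝓞 ↥(IntermediateField.adjoin ℚ ({β} : Set (AlgebraicClosure ℚ)))) * θI + (2 : 𝓞 ↥(IntermediateField.adjoin ℚ ({β} : Set (AlgebraicClosure ℚ)))) * δI) + 3 ∈ (Ideal.span {((3 : 𝓞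 ↥(IntermediateField.adjoin ℚ ({β} : Set (AlgebraicClosure ℚ)))) + (8 : 𝓞 ↥(IntermediateField.adjoin ℚ ({β} : Set (AlgebraicClosure ℚ)))) * θI + (-5 : 𝓞 ↥(IntermediateField.adjoin ℚ ({β} : Set (AlgebraicClosure ℚ)))) * δI)}) ^ 3 := by
    refine Or.inl ?_
    rw [Ideal.span_singleton_pow, Ideal.mem_span_singleton']
    exact ⟨((180701436 : 𝓞 ↥(IntermediateField.adjoin ℚ ({β} : Set (AlgebraicClosure ℚ)))) + (49479990 : 𝓞 ↥(IntermediateField.adjoin ℚ ({β} : Set (AlgebraicClosure ℚ)))) * θI + (59902760 : 𝓞 ↥(IntermediateField.adjoin ℚ ({β} : Set (AlgebraicClosure ℚ)))) * δI), by linear_combination ((19085850384 : 𝓞 ↥(IntermediateField.adjoin ℚ ({β} : Set (AlgebraicClosure ℚ)))) + (-107096894560 : 𝓞 ↥(IntermediateField.adjoin ℚ ({β} : Set (AlgebraicClosure ℚ)))) * δI + (-27818655600 : 𝓞 ↥(IntermediateField.adjoin ℚ ({β} : Set (AlgebraicClosure ℚ)))) * δI ^ 2 + (95685854592 : 𝓞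 ↥(IntermediateField.adjoin ℚ ({β} : Set (AlgebraicClosure ℚ)))) * θI + (-16830577280 : 𝓞 ↥(IntermediateField.adjoin ℚ ({β} : Set (AlgebraicClosure ℚ)))) * θI * δI + (25333754880 : 𝓞 ↥(IntermediateField.adjoin ℚ ({β} : Set (AlgebraicClosure ℚ)))) * θI ^ 2) * hX2 + ((4710537534 : 𝓞 ↥(IntermediateField.adjoin ℚ ({β} : Set (AlgebraicClosure ℚ)))) + (40629993190 : 𝓞 ↥(IntermediateField.adjoin ℚ ({β} : Set (AlgebraicClosure ℚ)))) * δI + (29756657250 : 𝓞 ↥(IntermediateField.adjoin ℚ ({β} : Set (AlgebraicClosure ℚ)))) * δI ^ 2) * hXY + ((-5320404880 : 𝓞 ↥(IntermediateField.adjoin ℚ ({β} : Set (AlgebraicClosure ℚ)))) + (-42478057450 : 𝓞 ↥(IntermediateField.adjoin ℚ ({β} : Set (AlgebraicClosure ℚ)))) * δI + (-7487845000 : 𝓞 ↥(IntermediateField.adjoin ℚ ({β} : Set (AlgebraicClosure ℚ)))) * δI ^ 2) * hY2⟩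
  have hπb : ((-29 : 𝓞 ↥(IntermediateField.adjoin ℚ ({β} : Set (AlgebraicClosure ℚ)))) + (6 : 𝓞 ↥(IntermediateField.adjoin ℚ ({β} : Set (AlgebraicClosure ℚ)))) * δI) - 3 ∈ (Ideal.span {((3 : 𝓞 ↥(IntermediateField.adjoin ℚ ({β} : Set (AlgebraicClosure ℚ)))) + (1 : 𝓞 ↥(IntermediateField.adjoin ℚ ({β} : Set (AlgebraicClosure ℚ)))) * θI + (1 : 𝓞 ↥(IntermediateField.adjoin ℚ ({β} : Set (AlgebraicClosure ℚ)))) * δI)}) ^ 3 ∨ ((-29 : 𝓞 ↥(IntermediateField.adjoin ℚ ({β} : Set (AlgebraicClosure ℚ)))) + (6 : 𝓞 ↥(IntermediateField.adjoin ℚ ({β} : Set (AlgebraicClosure ℚ)))) * δI) + 3 ∈ (Ideal.span {((3 : 𝓞 ↥(IntermediateField.adjoin ℚ ({β} : Set (AlgebraicClosure ℚ)))) + (1 : 𝓞 ↥(IntermediateField.adjoin ℚ ({β} : Set (AlgebraicClosure ℚ)))) * θI + (1 : 𝓞 ↥(IntermediateField.adjoin ℚ ({β} : Set (AlgebraicClosure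 ℚ)))) * δI)}) ^ 3 := by
    refine Or.inl ?_
    rw [Ideal.span_singleton_pow, Ideal.mem_span_singleton']
    exact ⟨((-376 : 𝓞 ↥(IntermediateField.adjoin ℚ ({β} : Set (AlgebraicClosure ℚ)))) + (45 : 𝓞 ↥(IntermediateField.adjoin ℚ ({β} : Set (AlgebraicClosure ℚ)))) * θI + (53 : 𝓞 ↥(IntermediateField.adjoin ℚ ({β} : Set (AlgebraicClosure ℚ)))) * δI), by linear_combination ((-2153 : 𝓞 ↥(IntermediateField.adjoin ℚ ({β} : Set (AlgebraicClosure ℚ)))) + (61 : 𝓞 ↥(IntermediateField.adjoin ℚ ({β} : Set (AlgebraicClosure ℚ)))) * δI + (294 : 𝓞 ↥(IntermediateField.adjoin ℚ ({β} : Set (AlgebraicClosure ℚ)))) * δI ^ 2 + (-16 : 𝓞 ↥(IntermediateField.adjoin ℚ ({β} : Set (AlgebraicClosure ℚ)))) * θI + (188 : 𝓞 ↥(IntermediateField.adjoin ℚ ({β} : Set (AlgebraicClosure ℚ)))) * θI * δI + (45 : 𝓞 ↥(IntermediateField.adjoin ℚ ({β} : Set (AlgebraicClosure ℚ)))) * θI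 ^ 2) * hX2 + ((-431 : 𝓞 ↥(IntermediateField.adjoin ℚ ({β} : Set (AlgebraicClosure ℚ)))) + (525 : 𝓞 ↥(IntermediateField.adjoin ℚ ({β} : Set (AlgebraicClosure ℚ)))) * δI + (204 : 𝓞 ↥(IntermediateField.adjoin ℚ ({β} : Set (AlgebraicClosure ℚ)))) * δI ^ 2) * hXY + ((1696 : 𝓞 ↥(IntermediateField.adjoin ℚ ({β} : Set (AlgebraicClosure ℚ)))) + (946 : 𝓞 ↥(IntermediateField.adjoin ℚ ({β} : Set (AlgebraicClosure ℚ)))) * δI + (53 : 𝓞 ↥(IntermediateField.adjoin ℚ ({β} : Set (AlgebraicClosure ℚ)))) * δI ^ 2) * hY2⟩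
  have hπc : ((7 : 𝓞 ↥(IntermediateField.adjoin ℚ ({β} : Set (AlgebraicClosure ℚ)))) + (2 : 𝓞 ↥(IntermediateField.adjoin ℚ ({β} : Set (AlgebraicClosure ℚ)))) * θI + (2 : 𝓞 ↥(IntermediateField.adjoin ℚ ({β} : Set (AlgebraicClosure ℚ)))) * δI) * ((-29 : 𝓞 ↥(IntermediateField.adjoin ℚ ({β} : Set (AlgebraicClosure ℚ)))) + (6 : 𝓞 ↥(IntermediateField.adjoin ℚ ({β} : Set (AlgebraicClosure ℚ)))) * δI) - 3 ∈ (Ideal.span {((18 : 𝓞 ↥(IntermediateField.adjoin ℚ ({β} : Set (AlgebraicClosure ℚ)))) + (5 : 𝓞 ↥(IntermediateField.adjoin ℚ ({β} : Set (AlgebraicClosure ℚ)))) * θI + (6 : 𝓞 ↥(IntermediateField.adjoin ℚ ({β} : Set (AlgebraicClosure ℚ)))) * δI)}) ^ 3 ∨ ((7 : 𝓞 ↥(IntermediateField.adjoin ℚ ({β} : Set (AlgebraicClosure ℚ)))) + (2 : 𝓞 ↥(IntermediateField.adjoin ℚ ({β} : Set (AlgebraicClosure ℚ)))) * θI + (2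 : 𝓞 ↥(IntermediateField.adjoin ℚ ({β} : Set (AlgebraicClosure ℚ)))) * δI) * ((-29 : 𝓞 ↥(IntermediateField.adjoin ℚ ({β} : Set (AlgebraicClosure ℚ)))) + (6 : 𝓞 ↥(IntermediateField.adjoin ℚ ({β} : Set (AlgebraicClosure ℚ)))) * δI) + 3 ∈ (Ideal.span {((18 : 𝓞 ↥(IntermediateField.adjoin ℚ ({β} : Set (AlgebraicClosure ℚ)))) + (5 : 𝓞 ↥(IntermediateField.adjoin ℚ ({β} : Set (AlgebraicClosure ℚ)))) * θI + (6 : 𝓞 ↥(IntermediateField.adjoin ℚ ({β} : Set (AlgebraicClosure ℚ)))) * δI)}) ^ 3 := by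
    refine Or.inr ?_
    rw [Ideal.span_singleton_pow, Ideal.mem_span_singleton']
    exact ⟨((-3869 : 𝓞 ↥(IntermediateField.adjoin ℚ ({β} : Set (AlgebraicClosure ℚ)))) + (1017 : 𝓞 ↥(IntermediateField.adjoin ℚ ({β} : Set (AlgebraicClosure ℚ)))) * θI + (242 : 𝓞 ↥(IntermediateField.adjoin ℚ ({β} : Set (AlgebraicClosure ℚ)))) * δI), by linear_combination ((-1042730 : 𝓞 ↥(IntermediateField.adjoin ℚ ({β} : Set (AlgebraicClosure ℚ)))) + (1647080 : 𝓞 ↥(IntermediateField.adjoin ℚ ({β} : Set (AlgebraicClosure ℚ)))) * δI + (658080 : 𝓞 ↥(IntermediateField.adjoin ℚ ({β} : Set (AlgebraicClosure ℚ)))) * δI ^ 2 + (762200 : 𝓞 ↥(IntermediateField.adjoin ℚ ({β} : Set (AlgebraicClosure ℚ)))) * θI + (487900 : 𝓞 ↥(IntermediateField.adjoin ℚ ({β} : Set (AlgebraicClosure ℚ)))) * θI * δI + (127125 : 𝓞 ↥(IntermediateField.adjoin ℚ ({β} : Set (AlgebraicClosure ℚ)))) * θI ^ 2) * hX2 + ((-136876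 : 𝓞 ↥(IntermediateField.adjoin ℚ ({β} : Set (AlgebraicClosure ℚ)))) + (1198676 : 𝓞 ↥(IntermediateField.adjoin ℚ ({β} : Set (AlgebraicClosure ℚ)))) * δI + (350352 : 𝓞 ↥(IntermediateField.adjoin ℚ ({β} : Set (AlgebraicClosure ℚ)))) * δI ^ 2) * hXY + ((2957352 : 𝓞 ↥(IntermediateField.adjoin ℚ ({β} : Set (AlgebraicClosure ℚ)))) + (1353528 : 𝓞 ↥(IntermediateField.adjoin ℚ ({β} : Set (AlgebraicClosure ℚ)))) * δI + (52272 : 𝓞 ↥(IntermediateField.adjoin ℚ ({β} : Set (AlgebraicClosure ℚ)))) * δI ^ 2) * hY2⟩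
  -- residue symbols `ψ_17(q₁) = 0`, `ψ_97(q₂) = 0`
  have hψq : ψ ((7 : 𝓞 ↥(IntermediateField.adjoin ℚ ({β} : Set (AlgebraicClosure ℚ)))) + (2 : 𝓞 ↥(IntermediateField.adjoin ℚ ({β} : Set (AlgebraicClosure ℚ)))) * θI + (2 : 𝓞 ↥(IntermediateField.adjoin ℚ ({β} : Set (AlgebraicClosure ℚ)))) * δI) = 0 := by
    simp only [map_add, map_mul, map_ofNat, hψ, hψδ]; decide
  have hωq : ω ((-29 : 𝓞 ↥(IntermediateField.adjoin ℚ ({β} : Set (AlgebraicClosure ℚ)))) + (6 : 𝓞 ↥(IntermediateField.adjoin ℚ ({β} : Set (AlgebraicClosure ℚ)))) * δI) = 0 := by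
    simp only [map_add, map_mul, map_neg, map_ofNat, hωδ]; decide
  -- the norm of the second generator is `q₂⁴` on the nose (`ε_z = 1`)
  have hone : (1 : 𝓞 ↥(IntermediateField.adjoin ℚ ({β} : Set (AlgebraicClosure ℚ)))) * 1 = 1 := one_mul 1
  exact AlignedTransportAtTwoCubicSplitStratumRelationMatrixCoordDoor.classicalMuVanishes_adjoin_of_relationMatrixCert_layer_two c29359b1 ht Δ_neg_c29359b1 hβ hh hd
    hnsq (Ideal.span {((3 : 𝓞 ↥(IntermediateField.adjoin ℚ ({β} : Set (AlgebraicClosure ℚ)))) + (8 : 𝓞 ↥(IntermediateField.adjoin ℚ ({β} : Set (AlgebraicClosure ℚ)))) * θI + (-5 : 𝓞 ↥(IntermediateField.adjoin ℚ ({β} : Set (AlgebraicClosure ℚ)))) * δI)}) (Ideal.span {((3 : 𝓞 ↥(IntermediateField.adjoin ℚ ({β} : Set (AlgebraicClosure ℚ)))) + (1 : 𝓞 ↥(IntermediateField.adjoin ℚ ({β} : Set (AlgebraicClosure ℚ)))) * θI + (1 : 𝓞 ↥(IntermediateField.adjoin ℚ ({β} : Set (AlgebraicClosure ℚ)))) *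 δI)}) (Ideal.span {((18 : 𝓞 ↥(IntermediateField.adjoin ℚ ({β} : Set (AlgebraicClosure ℚ)))) + (5 : 𝓞 ↥(IntermediateField.adjoin ℚ ({β} : Set (AlgebraicClosure ℚ)))) * θI + (6 : 𝓞 ↥(IntermediateField.adjoin ℚ ({β} : Set (AlgebraicClosure ℚ)))) * δI)}) hNC hNB hNA hεC hεB hεA κP hκP
    ((7 : 𝓞 ↥(IntermediateField.adjoin ℚ ({β} : Set (AlgebraicClosure ℚ)))) + (2 : 𝓞 ↥(IntermediateField.adjoin ℚ ({β} : Set (AlgebraicClosure ℚ)))) * θI + (2 : 𝓞 ↥(IntermediateField.adjoin ℚ ({β} : Set (AlgebraicClosure ℚ)))) * δI) ((-29 : 𝓞 ↥(IntermediateField.adjoin ℚ ({β} : Set (AlgebraicClosure ℚ)))) + (6 : 𝓞 ↥(IntermediateField.adjoin ℚ ({β} : Set (AlgebraicClosure ℚ)))) * δI) hmax1 hmax2 ((280 : 𝓞 ↥(IntermediateField.adjoin ℚ ({β} : Set (AlgebraicClosure ℚ)))) + (-240 : 𝓞 ↥(IntermediateField.adjoin ℚ ({β} : Set (AlgebraicClosure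 ℚ)))) * θI + (80 : 𝓞 ↥(IntermediateField.adjoin ℚ ({β} : Set (AlgebraicClosure ℚ)))) * δI) ((-3661 : 𝓞 ↥(IntermediateField.adjoin ℚ ({β} : Set (AlgebraicClosure ℚ)))) + (-1008 : 𝓞 ↥(IntermediateField.adjoin ℚ ({β} : Set (AlgebraicClosure ℚ)))) * θI + (-1218 : 𝓞 ↥(IntermediateField.adjoin ℚ ({β} : Set (AlgebraicClosure ℚ)))) * δI) (by linear_combination ((-480 : 𝓞 ↥(IntermediateField.adjoin ℚ ({β} : Set (AlgebraicClosure ℚ))))) * hX2 + ((-6368 : 𝓞 ↥(IntermediateField.adjoin ℚ ({β} : Set (AlgebraicClosure ℚ))))) * hXY + ((-7148 : 𝓞 ↥(IntermediateField.adjoin ℚ ({β} : Set (AlgebraicClosure ℚ))))) * hY2) hπa hπb hπc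
    (5 : ℤ) (4 : ℤ) (m₁ := 17) (m₂ := 97) (by norm_num) (by norm_num) ψ ω hψq hωq (ti₁ := 9) (ti₂ := 49) (by decide) (by decide) (by decide) (by decide)
    ((-209478 : 𝓞 ↥(IntermediateField.adjoin ℚ ({β} : Set (AlgebraicClosure ℚ)))) + (113986 : 𝓞 ↥(IntermediateField.adjoin ℚ ({β} : Set (AlgebraicClosure ℚ)))) * θI + (-19166 : 𝓞 ↥(IntermediateField.adjoin ℚ ({β} : Set (AlgebraicClosure ℚ)))) * δI) ((-477 : 𝓞 ↥(IntermediateField.adjoin ℚ ({β} : Set (AlgebraicClosure ℚ))))) (by push_cast; linear_combination ((-335568 : 𝓞 ↥(IntermediateField.adjoin ℚ ({β} : Set (AlgebraicClosure ℚ)))) + (89943600 : 𝓞 ↥(IntermediateField.adjoin ℚ ({β} : Set (AlgebraicClosure ℚ)))) * δI + (47870016 : 𝓞 ↥(IntermediateField.adjoin ℚ ({β} : Set (AlgebraicClosure ℚ)))) * δI ^ 2 + (5455168 : 𝓞 ↥(IntermediateField.adjoin ℚ ({β} : Set (AlgebraicClosure ℚ)))) * δI ^ 3 + (66767024 : 𝓞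 ↥(IntermediateField.adjoin ℚ ({β} : Set (AlgebraicClosure ℚ)))) * θI + (55557920 : 𝓞 ↥(IntermediateField.adjoin ℚ ({β} : Set (AlgebraicClosure ℚ)))) * θI * δI + (9716032 : 𝓞 ↥(IntermediateField.adjoin ℚ ({β} : Set (AlgebraicClosure ℚ)))) * θI * δI ^ 2 + (20357440 : 𝓞 ↥(IntermediateField.adjoin ℚ ({β} : Set (AlgebraicClosure ℚ)))) * θI ^ 2 + (6988448 : 𝓞 ↥(IntermediateField.adjoin ℚ ({β} : Set (AlgebraicClosure ℚ)))) * θI ^ 2 * δI + (1823776 : 𝓞 ↥(IntermediateField.adjoin ℚ ({β} : Set (AlgebraicClosure ℚ)))) * θI ^ 3) * hX2 + ((-12296912 : 𝓞 ↥(IntermediateField.adjoin ℚ ({β} : Set (AlgebraicClosure ℚ)))) + (25669712 : 𝓞 ↥(IntermediateField.adjoin ℚ ({β} : Set (AlgebraicClosure ℚ)))) * δI + (11996992 : 𝓞 ↥(IntermediateField.adjoin ℚ ({β} : Set (AlgebraicClosure ℚ)))) * δI ^ 2 + (597152 : 𝓞 ↥(IntermediateField.adjoin ℚ ({β} : Set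 (AlgebraicClosure ℚ)))) * δI ^ 3) * hXY + ((75197920 : 𝓞 ↥(IntermediateField.adjoin ℚ ({β} : Set (AlgebraicClosure ℚ)))) + (44154704 : 𝓞 ↥(IntermediateField.adjoin ℚ ({β} : Set (AlgebraicClosure ℚ)))) * δI + (3556000 : 𝓞 ↥(IntermediateField.adjoin ℚ ({β} : Set (AlgebraicClosure ℚ)))) * δI ^ 2 + (-306656 : 𝓞 ↥(IntermediateField.adjoin ℚ ({β} : Set (AlgebraicClosure ℚ)))) * δI ^ 3) * hY2)
    ((2385243334213 : 𝓞 ↥(IntermediateField.adjoin ℚ ({β} : Set (AlgebraicClosure ℚ)))) + (653131590624 : 𝓞 ↥(IntermediateField.adjoin ℚ ({β} : Set (AlgebraicClosure ℚ)))) * θI + (790711253622 : 𝓞 ↥(IntermediateField.adjoin ℚ ({β} : Set (AlgebraicClosure ℚ)))) * δI) ((-388857 : 𝓞 ↥(IntermediateField.adjoin ℚ ({β} : Set (AlgebraicClosure ℚ))))) (by push_cast; linear_combination ((-95392770186724992 : 𝓞 ↥(IntermediateField.adjoin ℚ ({β} : Set (AlgebraicClosure ℚ)))) + (59247010292513472 :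 𝓞 ↥(IntermediateField.adjoin ℚ ({β} : Set (AlgebraicClosure ℚ)))) * δI + (-12265817995898496 : 𝓞 ↥(IntermediateField.adjoin ℚ ({β} : Set (AlgebraicClosure ℚ)))) * δI ^ 2 + (846458541448704 : 𝓞 ↥(IntermediateField.adjoin ℚ ({β} : Set (AlgebraicClosure ℚ)))) * δI ^ 3) * hXY + ((-115486891137033336 : 𝓞 ↥(IntermediateField.adjoin ℚ ({β} : Set (AlgebraicClosure ℚ)))) + (71727165635691168 : 𝓞 ↥(IntermediateField.adjoin ℚ ({β} : Set (AlgebraicClosure ℚ)))) * δI + (-14849565483469968 : 𝓞 ↥(IntermediateField.adjoin ℚ ({β} : Set (AlgebraicClosure ℚ)))) * δI ^ 2 + (1024761784694112 : 𝓞 ↥(IntermediateField.adjoin ℚ ({β} : Set (AlgebraicClosure ℚ)))) * δI ^ 3) * hY2)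
    ((-259 : 𝓞 ↥(IntermediateField.adjoin ℚ ({β} : Set (AlgebraicClosure ℚ)))) + (222 : 𝓞 ↥(IntermediateField.adjoin ℚ ({β} : Set (AlgebraicClosure ℚ)))) * θI + (-74 : 𝓞 ↥(IntermediateField.adjoin ℚ ({β} : Set (AlgebraicClosure ℚ)))) * δI) ((6 : 𝓞 ↥(IntermediateField.adjoin ℚ ({β} : Set (AlgebraicClosure ℚ))))) (by push_cast; linear_combination ((444 : 𝓞 ↥(IntermediateField.adjoin ℚ ({β} : Set (AlgebraicClosure ℚ))))) * hX2 + ((296 : 𝓞 ↥(IntermediateField.adjoin ℚ ({β} : Set (AlgebraicClosure ℚ))))) * hXY + ((-148 : 𝓞 ↥(IntermediateField.adjoin ℚ ({β} : Set (AlgebraicClosure ℚ))))) * hY2)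
    ((21 : 𝓞 ↥(IntermediateField.adjoin ℚ ({β} : Set (AlgebraicClosure ℚ)))) + (-18 : 𝓞 ↥(IntermediateField.adjoin ℚ ({β} : Set (AlgebraicClosure ℚ)))) * θI + (6 : 𝓞 ↥(IntermediateField.adjoin ℚ ({β} : Set (AlgebraicClosure ℚ)))) * δI) ((5 : 𝓞 ↥(IntermediateField.adjoin ℚ ({β} : Set (AlgebraicClosure ℚ))))) (by push_cast; linear_combination ((-36 : 𝓞 ↥(IntermediateField.adjoin ℚ ({β} : Set (AlgebraicClosure ℚ))))) * hX2 + ((-24 : 𝓞 ↥(IntermediateField.adjoin ℚ ({β} : Set (AlgebraicClosure ℚ))))) * hXY + ((12 : 𝓞 ↥(IntermediateField.adjoin ℚ ({β} : Set (AlgebraicClosure ℚ))))) * hY2)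
    ((-189 : 𝓞 ↥(IntermediateField.adjoin ℚ ({β} : Set (AlgebraicClosure ℚ)))) + (162 : 𝓞 ↥(IntermediateField.adjoin ℚ ({β} : Set (AlgebraicClosure ℚ)))) * θI + (-54 : 𝓞 ↥(IntermediateField.adjoin ℚ ({β} : Set (AlgebraicClosure ℚ)))) * δI) ((-4 : 𝓞 ↥(IntermediateField.adjoin ℚ ({β} : Set (AlgebraicClosure ℚ))))) (by push_cast; linear_combination ((324 : 𝓞 ↥(IntermediateField.adjoin ℚ ({β} : Set (AlgebraicClosure ℚ))))) * hX2 + ((216 : 𝓞 ↥(IntermediateField.adjoin ℚ ({β} : Set (AlgebraicClosure ℚ))))) * hXY + ((-108 : 𝓞 ↥(IntermediateField.adjoin ℚ ({β} : Set (AlgebraicClosure ℚ))))) * hY2)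
    ((523 : 𝓞 ↥(IntermediateField.adjoin ℚ ({β} : Set (AlgebraicClosure ℚ)))) + (144 : 𝓞 ↥(IntermediateField.adjoin ℚ ({β} : Set (AlgebraicClosure ℚ)))) * θI + (174 : 𝓞 ↥(IntermediateField.adjoin ℚ ({β} : Set (AlgebraicClosure ℚ)))) * δI) ((-2 : 𝓞 ↥(IntermediateField.adjoin ℚ ({β} : Set (AlgebraicClosure ℚ))))) (by push_cast; linear_combination ((864 : 𝓞 ↥(IntermediateField.adjoin ℚ ({β} : Set (AlgebraicClosure ℚ))))) * hXY + ((1044 : 𝓞 ↥(IntermediateField.adjoin ℚ ({β} : Set (AlgebraicClosure ℚ))))) * hY2)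
    ((523 : 𝓞 ↥(IntermediateField.adjoin ℚ ({β} : Set (AlgebraicClosure ℚ)))) + (144 : 𝓞 ↥(IntermediateField.adjoin ℚ ({β} : Set (AlgebraicClosure ℚ)))) * θI + (174 : 𝓞 ↥(IntermediateField.adjoin ℚ ({β} : Set (AlgebraicClosure ℚ)))) * δI) ((12 : 𝓞 ↥(IntermediateField.adjoin ℚ ({β} : Set (AlgebraicClosure ℚ))))) (by push_cast; linear_combination ((864 : 𝓞 ↥(IntermediateField.adjoin ℚ ({β} : Set (AlgebraicClosure ℚ))))) * hXY + ((1044 : 𝓞 ↥(IntermediateField.adjoin ℚ ({β} : Set (AlgebraicClosure ℚ))))) * hY2)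
    ((-7845 : 𝓞 ↥(IntermediateField.adjoin ℚ ({β} : Set (AlgebraicClosure ℚ)))) + (-2160 : 𝓞 ↥(IntermediateField.adjoin ℚ ({β} : Set (AlgebraicClosure ℚ)))) * θI + (-2610 : 𝓞 ↥(IntermediateField.adjoin ℚ ({β} : Set (AlgebraicClosure ℚ)))) * δI) ((-26 : 𝓞 ↥(IntermediateField.adjoin ℚ ({β} : Set (AlgebraicClosure ℚ))))) (by push_cast; linear_combination ((-12960 : 𝓞 ↥(IntermediateField.adjoin ℚ ({β} : Set (AlgebraicClosure ℚ))))) * hXY + ((-15660 : 𝓞 ↥(IntermediateField.adjoin ℚ ({β} : Set (AlgebraicClosure ℚ))))) * hY2)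
    (fun i : ℕ => if i = 0 then 1 else if i = 1 then 1 else 0) (fun _ : ℕ => (0 : ℕ)) (fun _ : ℕ => (0 : ℕ)) (fun i : ℕ => if i = 0 then 2 else if i = 1 then 1 else if i = 2 then 1 else 0) (d := 2) (by norm_num) (u := X) (g := 1 + X + 2 * X ^ 2) (by norm_num)
    (by simp [Finset.sum_range_succ]; ring)
    ((1 : 𝓞 ↥(IntermediateField.adjoin ℚ ({β} : Set (AlgebraicClosure ℚ))))) ((-1 : 𝓞 ↥(IntermediateField.adjoin ℚ ({β} : Set (AlgebraicClosure ℚ))))) ((-1 : 𝓞 ↥(IntermediateField.adjoin ℚ ({β} : Set (AlgebraicClosure ℚ)))) + (-2 : 𝓞 ↥(IntermediateField.adjoin ℚ ({β} : Set (AlgebraicClosure ℚ)))) * θI + (1 : 𝓞 ↥(IntermediateField.adjoin ℚ ({β} : Set (AlgebraicClosure ℚ)))) * δI) ((-1 : 𝓞 ↥(IntermediateField.adjoin ℚ ({β} : Set (AlgebraicClosure ℚ)))) + (-1 : 𝓞 ↥(IntermediateField.adjoin ℚ ({β} : Set (AlgebraicClosure ℚ)))) * θI + (1 : 𝓞 ↥(IntermediateField.adjoin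 ℚ ({β} : Set (AlgebraicClosure ℚ)))) * δI) hy10 hy11 hy12 hy13 hy20 hy21 hy22 hy23
    (Units.mkOfMulEqOne _ _ hεmul) (by rw [Units.val_mkOfMulEqOne]; simp only [Finset.sum_range_succ, Finset.sum_range_zero]; norm_num; linear_combination ((16604 : 𝓞 ↥(IntermediateField.adjoin ℚ ({β} : Set (AlgebraicClosure ℚ)))) + (2584 : 𝓞 ↥(IntermediateField.adjoin ℚ ({β} : Set (AlgebraicClosure ℚ)))) * δI + (-8 : 𝓞 ↥(IntermediateField.adjoin ℚ ({β} : Set (AlgebraicClosure ℚ)))) * δI ^ 2 + (2232 : 𝓞 ↥(IntermediateField.adjoin ℚ ({β} : Set (AlgebraicClosure ℚ)))) * θI + (8 : 𝓞 ↥(IntermediateField.adjoin ℚ ({β} : Set (AlgebraicClosure ℚ)))) * θI ^ 2) * hX2 + ((3384 : 𝓞 ↥(IntermediateField.adjoin ℚ ({β} : Set (AlgebraicClosure ℚ)))) + (-1600 : 𝓞 ↥(IntermediateField.adjoin ℚ ({β} : Set (AlgebraicClosure ℚ)))) * δI) * hXY + ((-8570 : 𝓞 ↥(IntermediateField.adjoin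 ℚ ({β} : Set (AlgebraicClosure ℚ)))) + (-1950 : 𝓞 ↥(IntermediateField.adjoin ℚ ({β} : Set (AlgebraicClosure ℚ)))) * δI + (2 : 𝓞 ↥(IntermediateField.adjoin ℚ ({β} : Set (AlgebraicClosure ℚ)))) * δI ^ 2) * hY2)
    ((47 : 𝓞 ↥(IntermediateField.adjoin ℚ ({β} : Set (AlgebraicClosure ℚ)))) + (-120 : 𝓞 ↥(IntermediateField.adjoin ℚ ({β} : Set (AlgebraicClosure ℚ)))) * θI + (56 : 𝓞 ↥(IntermediateField.adjoin ℚ ({β} : Set (AlgebraicClosure ℚ)))) * δI) ((-41 : 𝓞 ↥(IntermediateField.adjoin ℚ ({β} : Set (AlgebraicClosure ℚ)))) + (83 : 𝓞 ↥(IntermediateField.adjoin ℚ ({β} : Set (AlgebraicClosure ℚ)))) * θI + (-37 : 𝓞 ↥(IntermediateField.adjoin ℚ ({β} : Set (AlgebraicClosure ℚ)))) * δI) ((-66 : 𝓞 ↥(IntermediateField.adjoin ℚ ({β} : Set (AlgebraicClosure ℚ)))) + (160 : 𝓞 ↥(IntermediateField.adjoin ℚ ({β} : Set (AlgebraicClosure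 ℚ)))) * θI + (-74 : 𝓞 ↥(IntermediateField.adjoin ℚ ({β} : Set (AlgebraicClosure ℚ)))) * δI) ((50 : 𝓞 ↥(IntermediateField.adjoin ℚ ({β} : Set (AlgebraicClosure ℚ)))) + (-112 : 𝓞 ↥(IntermediateField.adjoin ℚ ({β} : Set (AlgebraicClosure ℚ)))) * θI + (51 : 𝓞 ↥(IntermediateField.adjoin ℚ ({β} : Set (AlgebraicClosure ℚ)))) * δI) hz10 hz11 hz12 hz13 hz20 hz21 hz22 hz23
    (Units.mkOfMulEqOne _ _ hone) (by rw [Units.val_mkOfMulEqOne]; simp only [Finset.sum_range_succ, Finset.sum_range_zero]; norm_num; linear_combination ((-103608 : 𝓞 ↥(IntermediateField.adjoin ℚ ({β} : Set (AlgebraicClosure ℚ)))) + (104648 : 𝓞 ↥(IntermediateField.adjoin ℚ ({β} : Set (AlgebraicClosure ℚ)))) * δI + (1096 : 𝓞 ↥(IntermediateField.adjoin ℚ ({β} : Set (AlgebraicClosure ℚ)))) * δI ^ 2 + (-25908 : 𝓞 ↥(IntermediateField.adjoin ℚ ({β} : Set (AlgebraicClosure ℚ)))) * θI + (-10096 : 𝓞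 ↥(IntermediateField.adjoin ℚ ({β} : Set (AlgebraicClosure ℚ)))) * θI * δI + (5956 : 𝓞 ↥(IntermediateField.adjoin ℚ ({β} : Set (AlgebraicClosure ℚ)))) * θI ^ 2) * hX2 + ((126952 : 𝓞 ↥(IntermediateField.adjoin ℚ ({β} : Set (AlgebraicClosure ℚ)))) + (-97528 : 𝓞 ↥(IntermediateField.adjoin ℚ ({β} : Set (AlgebraicClosure ℚ)))) * δI + (3568 : 𝓞 ↥(IntermediateField.adjoin ℚ ({β} : Set (AlgebraicClosure ℚ)))) * δI ^ 2) * hXY + ((-38952 : 𝓞 ↥(IntermediateField.adjoin ℚ ({β} : Set (AlgebraicClosure ℚ)))) + (43148 : 𝓞 ↥(IntermediateField.adjoin ℚ ({β} : Set (AlgebraicClosure ℚ)))) * δI + (-2452 : 𝓞 ↥(IntermediateField.adjoin ℚ ({β} : Set (AlgebraicClosure ℚ)))) * δI ^ 2) * hY2)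

end Summit.BirchSwinnertonDyer.BirchSwinnertonDyer.Theorems.AlignedTransportAtTwoCubicSplitStratumRelationMatrixRowN1727

end
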